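import Summits.RiemannHypothesis.RiemannHypothesis.Theorems.WeilGroundStateGroundStatesConvergeToXiStubInterpolationOfRH
import HarnessLib

/-!
# Stub `stub_interpolation` of the line `Sketch` (crux `WeilGroundState.GroundStatesConvergeToXi`,
item stmt-RiemannHypothesis-1527, rev L9)

**RH-free sinc interpolation of Weil ground states.**  For a ground state `u` at the window `a`
and every `s : ℂ`: `ε(a) û(s) = Σ_ρ m(ρ) û(ρ) K_a(s - ρ)`, `K_a(w) = ∫_{[-a,a]} e^{wx} dx`, the sum
over ALL non-trivial zeros of `ζ` converging absolutely, GIVEN (as hypotheses) the RH-free sampling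
inequality `Σ_ρ m(ρ)‖û(ρ)‖²/log(|Im ρ|+2) < ∞` for windowed `L²` functions and the zero count
`Σ_ρ m(ρ) log(|Im ρ|+2)/‖s-ρ‖² < ∞`.

Proof (the template is c6's `stub_interpolation_of_RH`, whose helper lemmas `interpolation_*` are
re-used by name): the RH-free zero-side Euler–Lagrange equation `hasSum_zeroSide_eulerLagrange`,
`Σ_ρ m(ρ) û(ρ) conj ĥ(1 - conj ρ) = ε(a) ∫ u conj h`, is tested against
`hₙ(t) = χₙ(t) e^{(conj s - 1/2)t}` with the smooth plateau cut-offs `χₙ(t) = cutoff (n a - 1) (n t)`;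
here `conj ĥₙ(1 - conj ρ) = ∫ χₙ e^{(s-ρ)t}` is the SAME kernel as under RH.  Dominated convergence
in `t` and Tannery's theorem in `ρ`: integrating by parts once,
`‖∫ χₙ e^{wt}‖ ≤ 4 D e^{a|Re w|}/‖w‖ ≤ 4 D e^{a(|Re s|+1)}/‖w‖` uniformly in `n` (`0 < Re ρ < 1`),
and the weighted AM–GM inequality `m‖û‖P ≤ K (m‖û‖²/L + m L/‖s-ρ‖²)` (`L = log(|Im ρ|+2) > 0`)
makes the majorant summable by the two hypotheses.  Tree + Mathlib only.
-/

set_option linter.dupNamespace false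

noncomputable section

open MeasureTheory Complex Filter Set
open scoped Real Topology ComplexConjugate ContDiff

namespace Summit.RiemannHypothesis.RiemannHypothesis.Theorems.GroundStatesConvergeToXi

open Literature.NumberTheory.LFunctions Literature.Analysis.Calculus

/-- Weighted AM–GM step of the RH-free majorant: `m U P ≤ K (m U²/L + m L/d²)` when
`P d ≤ 2K` and `L > 0` (from `2U/d ≤ U²/L + L/d²`). [folklore] -/
theorem interpolationRHfree_amgm {m U P d K L : ℝ} (hm : 0 ≤ m) (hU : 0 ≤ U) (hd : 0 < d)
    (hK : 0 ≤ K) (hL : 0 < L) (hP : P * d ≤ 2 * K) :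
    m * (U * P) ≤ K * (m * U ^ 2 / L + m * L / d ^ 2) := by
  have h1 : P ≤ 2 * K / d := by rwa [le_div_iff₀ hd]
  have h2 : 2 * U / d ≤ U ^ 2 / L + L / d ^ 2 := by
    rw [div_add_div _ _ hL.ne' (pow_ne_zero 2 hd.ne'), div_le_div_iff₀ hd (by positivity)]
    nlinarith [mul_nonneg hd.le (sq_nonneg (U * d - L))]
  calc m * (U * P) ≤ m * (U * (2 * K / d)) := by gcongr
    _ = K * m * (2 * U / d) := by ring
    _ ≤ K * m * (U ^ 2 / L + L / d ^ 2) := by gcongr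
    _ = K * (m * U ^ 2 / L + m * L / d ^ 2) := by ring

/-- The RH-free Euler–Lagrange kernel is the RH one:
`conj ((χ e^{(conj s - 1/2)·})^(1 - conj ρ)) = ∫ χ(t) e^{(s - ρ)t} dt` for real `χ`. [folklore] -/
theorem interpolationRHfree_conj_weilMellin (χ : ℝ → ℝ) (s ρ : ℂ) :
    conj (weilMellin (fun t : ℝ ↦ (χ t : ℂ) * cexp ((conj s - 1 / 2) * t)) (1 - conj ρ)) =
      ∫ t : ℝ, (χ t : ℂ) * cexp ((s - ρ) * t) := by
  have h : conj (1 - conj ρ) = 1 - ρ := by rw [map_sub, map_one, Complex.conj_conj]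
  rw [interpolation_conj_weilMellin, h, show s + (1 - ρ) - 1 = s - ρ by ring]

/-- Off the critical line too, `e^{a|Re(s-ρ)|} ≤ e^{a(|Re s|+1)}` at a non-trivial zero `ρ`
(`0 < Re ρ < 1`), for `0 ≤ a`. [folklore] -/
theorem interpolationRHfree_exp_le {a : ℝ} (ha : 0 ≤ a) (s : ℂ)
    (ρ : ZetaZeros.riemannZetaNontrivialZeros) :
    Real.exp (a * |(s - (ρ : ℂ)).re|) ≤ Real.exp (a * (|s.re| + 1)) := by
  refine Real.exp_le_exp.2 (mul_le_mul_of_nonneg_left ?_ ha)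
  have h0 := ZetaZeros.riemannZetaNontrivialZeros.re_pos ρ.2
  have h1 := ZetaZeros.riemannZetaNontrivialZeros.re_lt_one ρ.2
  rw [sub_re]
  exact abs_le.2 ⟨by linarith [neg_abs_le s.re], by linarith [le_abs_self s.re]⟩

/-- **Stub `stub_interpolation` (W7 — the RH-free sinc-interpolation identity for Weil ground
states).**  Given the RH-free sampling inequality at the zeros for windowed `L²` functions
(`Σ_ρ m(ρ)‖û(ρ)‖²/log(|Im ρ|+2) ≤ C(1+a²)²eᵃ‖u‖₂²`, the conclusion of W6c) and the zero count
`Σ_ρ m(ρ) log(|Im ρ|+2)/‖s-ρ‖² < ∞` (W6d (ii)): for every Weil ground state `u` at the window `a`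
and every `s : ℂ`, `Σ_ρ m(ρ) û(ρ) ∫_{[-a,a]} e^{(s-ρ)x} dx = ε(a) û(s)`, the sum over all
non-trivial zeros of `ζ` converging absolutely (`hasSum_zeroSide_eulerLagrange` against smooth
cut-offs of `1_{[-a,a]} e^{(conj s - 1/2)t}`; dominated convergence in `t`, Tannery in `ρ` with the
weighted AM–GM majorant). [folklore] -/
theorem stub_interpolation :
    (∃ C : ℝ, 0 < C ∧ ∀ (a : ℝ) (u : ℝ → ℂ), 0 < a → MemLp u 2 volume →
      (∀ᵐ t : ℝ, t ∉ Icc (-a) a → u t = 0) →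
        Summable (fun ρ : ZetaZeros.riemannZetaNontrivialZeros =>
          (riemannZetaZeroOrder (ρ : ℂ) : ℝ) * ‖weilMellin u ρ‖ ^ 2 / Real.log (|(ρ : ℂ).im| + 2)) ∧
        ∑' ρ : ZetaZeros.riemannZetaNontrivialZeros,
            (riemannZetaZeroOrder (ρ : ℂ) : ℝ) * ‖weilMellin u ρ‖ ^ 2 / Real.log (|(ρ : ℂ).im| + 2) ≤
          C * (1 + a ^ 2) ^ 2 * Real.exp a * ∫ y : ℝ, ‖u y‖ ^ 2) →
    (∀ s : ℂ, Summable fun ρ : ZetaZeros.riemannZetaNontrivialZeros =>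
      (riemannZetaZeroOrder (ρ : ℂ) : ℝ) * Real.log (|(ρ : ℂ).im| + 2) / ‖s - (ρ : ℂ)‖ ^ 2) →
    ∀ (a : ℝ) (u : ℝ → ℂ) (s : ℂ), IsWeilGroundState a u →
      HasSum (fun ρ : ZetaZeros.riemannZetaNontrivialZeros =>
          (riemannZetaZeroOrder (ρ : ℂ) : ℂ) *
            (weilMellin u ρ * ∫ x in Icc (-a) a, cexp ((s - (ρ : ℂ)) * x)))
        ((weilGroundEnergy a : ℂ) * weilMellin u s) := by
  intro HS HL a u s hu
  classical
  obtain ⟨D, hD0, hD⟩ := exists_bound_deriv_cutoff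
  obtain ⟨_, -, hC⟩ := HS
  have hSu := (hC a u hu.pos hu.memLp hu.ae_eq_zero_of_notMem).1
  have ha : 0 < a := hu.pos
  set E : ℝ := Real.exp (a * (|s.re| + 1)) with hE
  have hE0 : 0 < E := Real.exp_pos _
  have hexpE : ∀ ρ : ZetaZeros.riemannZetaNontrivialZeros,
      Real.exp (a * |(s - (ρ : ℂ)).re|) ≤ E := fun ρ ↦ interpolationRHfree_exp_le ha.le s ρ
  -- `P n w = ∫ χₙ(t) e^{wt} dt`, the terms `T n ρ = m(ρ) û(ρ) P n (s - ρ)` and their limits `Tu ρ`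
  set P : ℕ → ℂ → ℂ := fun n w ↦
    ∫ t : ℝ, ((cutoff (n * a - 1) (n * t) : ℝ) : ℂ) * cexp (w * t) with hP
  set T : ℕ → ZetaZeros.riemannZetaNontrivialZeros → ℂ := fun n ρ ↦
    (riemannZetaZeroOrder (ρ : ℂ) : ℂ) * (weilMellin u ρ * P n (s - ρ)) with hT
  set Tu : ZetaZeros.riemannZetaNontrivialZeros → ℂ := fun ρ ↦ (riemannZetaZeroOrder (ρ : ℂ) : ℂ) *
    (weilMellin u ρ * ∫ x in Icc (-a) a, cexp ((s - (ρ : ℂ)) * x)) with hTu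
  -- Step 1: the RH-free Euler–Lagrange equation tested against `hₙ = χₙ e^{(conj s - 1/2)t}`
  have hEL : ∀ n : ℕ, HasSum (T n) ((weilGroundEnergy a : ℂ) *
      ∫ t : ℝ, u t * (((cutoff (n * a - 1) (n * t) : ℝ) : ℂ) * cexp ((s - 1 / 2) * t))) := by
    intro n
    obtain ⟨hh, hhs⟩ := interpolation_isWeilTest_ofReal_mul_cexp
      (interpolation_contDiff_cutoffSeq a n) (fun t ↦ interpolation_cutoffSeq_eq_zero n)
      (conj s - 1 / 2)
    have h := hasSum_zeroSide_eulerLagrange hu hh hhs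
    simp only [interpolation_conj_ofReal_mul_cexp] at h
    refine h.congr_fun fun ρ ↦ ?_
    simp only [hT, hP]
    rw [interpolationRHfree_conj_weilMellin]
  -- Step 2: the two dominated-convergence limits
  have hlim : Tendsto (fun n : ℕ ↦ (weilGroundEnergy a : ℂ) *
      ∫ t : ℝ, u t * (((cutoff (n * a - 1) (n * t) : ℝ) : ℂ) * cexp ((s - 1 / 2) * t))) atTop
      (𝓝 ((weilGroundEnergy a : ℂ) * weilMellin u s)) := by
    have h := interpolation_tendsto_integral_mul_cutoffSeq (a := a) (s - 1 / 2) hu.memLp.1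
      (hu.integrable_mul_cexp _).integrableOn
    rw [setIntegral_eq_integral_of_ae_compl_eq_zero
      (hu.ae_eq_zero_of_notMem.mono fun t ht hts ↦ by rw [ht hts, zero_mul])] at h
    exact h.const_mul _
  have hterm : ∀ ρ : ZetaZeros.riemannZetaNontrivialZeros,
      Tendsto (fun n ↦ T n ρ) atTop (𝓝 (Tu ρ)) := fun ρ ↦ by
    have h := interpolation_tendsto_integral_mul_cutoffSeq (a := a) (s - ρ) aestronglyMeasurable_const
      ((by fun_prop : Continuous fun t : ℝ ↦ (1 : ℂ) * cexp ((s - ρ) * t)).integrableOn_Icc)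
    simp only [one_mul] at h
    exact (h.const_mul (weilMellin u ρ)).const_mul _
  -- Step 3: the two bounds on `P n (s - ρ)` (crude, and by one integration by parts)
  have hP1 (n : ℕ) (ρ : ZetaZeros.riemannZetaNontrivialZeros) : ‖P n (s - ρ)‖ ≤ 2 * a * E :=
    (interpolation_norm_integral_ofReal_mul_cexp_le
      (χ := fun t ↦ cutoff (n * a - 1) (n * t)) ha.le (fun t ↦ cutoff_nonneg _ _)
      (fun t ↦ cutoff_le_one _ _) (fun t ht ↦ interpolation_cutoffSeq_eq_zero n ht) (s - ρ)).trans
      (mul_le_mul_of_nonneg_left (hexpE ρ) (mul_nonneg zero_le_two ha.le))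
  have hP2 (n : ℕ) (ρ : ZetaZeros.riemannZetaNontrivialZeros) (hn : 0 < n) :
      ‖(s - (ρ : ℂ)) * P n (s - ρ)‖ ≤ 4 * D * E :=
    calc ‖(s - (ρ : ℂ)) * P n (s - ρ)‖
        ≤ ∫ t : ℝ, |deriv (fun t : ℝ ↦ cutoff (n * a - 1) (n * t)) t| *
            Real.exp ((s - (ρ : ℂ)).re * t) :=
          interpolation_norm_mul_integral_le (interpolation_contDiff_cutoffSeq a n)
            (HasCompactSupport.intro isCompact_Icc fun _ ht ↦
              interpolation_cutoffSeq_eq_zero n (interpolation_le_abs_of_notMem_Icc ht)) _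
      _ ≤ 4 * D * Real.exp (a * |(s - (ρ : ℂ)).re|) :=
          interpolation_integral_abs_deriv_cutoffSeq_le hD a (Nat.cast_pos.2 hn) _
      _ ≤ 4 * D * E := mul_le_mul_of_nonneg_left (hexpE ρ) (mul_nonneg (by norm_num) hD0)
  -- Step 4: the summable majorant (weighted AM–GM; one-point correction at `ρ = s`)
  set bound : ZetaZeros.riemannZetaNontrivialZeros → ℝ := fun ρ ↦
    2 * D * E * ((riemannZetaZeroOrder (ρ : ℂ) : ℝ) * ‖weilMellin u ρ‖ ^ 2 /
        Real.log (|(ρ : ℂ).im| + 2) +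
      (riemannZetaZeroOrder (ρ : ℂ) : ℝ) * Real.log (|(ρ : ℂ).im| + 2) / ‖s - (ρ : ℂ)‖ ^ 2) +
    (if (ρ : ℂ) = s then 2 * a * E * ((riemannZetaZeroOrder (ρ : ℂ) : ℝ) * ‖weilMellin u ρ‖)
      else 0) with hbound
  have hfin : ({ρ : ZetaZeros.riemannZetaNontrivialZeros | (ρ : ℂ) = s} :
      Set ZetaZeros.riemannZetaNontrivialZeros).Finite :=
    Set.Subsingleton.finite fun ρ hρ ρ' hρ' ↦ Subtype.ext (hρ.trans hρ'.symm)
  have hbound_summ : Summable bound :=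
    (((hSu.add (HL s)).mul_left (2 * D * E)).add
      (summable_of_hasFiniteSupport (hfin.subset fun ρ hρ ↦ of_not_not fun h ↦ hρ (if_neg h))))
  have hdom : ∀ᶠ n : ℕ in atTop, ∀ ρ, ‖T n ρ‖ ≤ bound ρ := by
    filter_upwards [eventually_gt_atTop 0] with n hn ρ
    have hm : (0 : ℝ) ≤ riemannZetaZeroOrder (ρ : ℂ) := by
      exact_mod_cast riemannZetaZeroOrder_nonneg (ZetaZeros.riemannZetaNontrivialZeros.ne_one ρ.2)
    have hL : 0 < Real.log (|(ρ : ℂ).im| + 2) :=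
      Real.log_pos (by linarith [abs_nonneg (ρ : ℂ).im])
    have hT' : ‖T n ρ‖ =
        (riemannZetaZeroOrder (ρ : ℂ) : ℝ) * (‖weilMellin u ρ‖ * ‖P n (s - ρ)‖) := by
      simp only [hT, norm_mul, Complex.norm_intCast, abs_of_nonneg hm]
    have h0 : 0 ≤ 2 * D * E * ((riemannZetaZeroOrder (ρ : ℂ) : ℝ) * ‖weilMellin u ρ‖ ^ 2 /
          Real.log (|(ρ : ℂ).im| + 2) +
        (riemannZetaZeroOrder (ρ : ℂ) : ℝ) * Real.log (|(ρ : ℂ).im| + 2) / ‖s - (ρ : ℂ)‖ ^ 2) :=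
      mul_nonneg (mul_nonneg (mul_nonneg zero_le_two hD0) hE0.le)
        (add_nonneg (div_nonneg (mul_nonneg hm (sq_nonneg _)) hL.le)
          (div_nonneg (mul_nonneg hm hL.le) (sq_nonneg _)))
    rw [hT']
    by_cases hρs : (ρ : ℂ) = s
    · -- the (at most one) index `ρ = s`: crude bound
      have h1 := mul_le_mul_of_nonneg_left
        (mul_le_mul_of_nonneg_left (hP1 n ρ) (norm_nonneg (weilMellin u ρ))) hm
      simp only [hbound, if_pos hρs]
      linarith
    · -- `ρ ≠ s`: integration-by-parts bound and weighted AM–GM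
      have h1 := hP2 n ρ hn
      rw [norm_mul] at h1
      simp only [hbound, if_neg hρs, add_zero]
      exact interpolationRHfree_amgm hm (norm_nonneg _)
        (norm_pos_iff.2 (sub_ne_zero.2 (Ne.symm hρs))) (mul_nonneg (mul_nonneg zero_le_two hD0) hE0.le)
        hL (by linarith)
  -- Step 5: Tannery and identification of the limits
  have hTann := tendsto_tsum_of_dominated_convergence hbound_summ hterm hdom
  have heq : ∑' ρ, Tu ρ = (weilGroundEnergy a : ℂ) * weilMellin u s :=
    tendsto_nhds_unique hTann (hlim.congr fun n ↦ (hEL n).tsum_eq.symm)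
  have hTu_le : ∀ ρ, ‖Tu ρ‖ ≤ bound ρ := fun ρ ↦
    le_of_tendsto (hterm ρ).norm (hdom.mono fun n hn ↦ hn ρ)
  rw [← heq]
  exact (Summable.of_norm_bounded hbound_summ hTu_le).hasSum

end Summit.RiemannHypothesis.RiemannHypothesis.Theorems.GroundStatesConvergeToXi

end
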